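import Literature.Geometry.Riemannian.CutLocus
import HarnessLib

/-!
# The cut locus of a point: metric (Hopf–Rinow-type) lemmas — layer 0 of Buchner 1977

Sibling proof file of `Literature/Geometry/Riemannian/CutLocus.lean`, working towards the named
fact `buchner1977_cutLocus_triangulable` (Buchner 1977: the cut locus of a point of a compact
real-analytic Riemannian manifold is homeomorphic to a finite simplicial complex of dimension
`≤ n - 1`). The printed proof (Proc. AMS 64 (1977) 118–121) rests on four layers absent from
Mathlib: the classical cut-locus theory of a complete Riemannian manifold (exponential map,
Hopf–Rinow, minimal geodesics; p. 118), Milnor's finite-dimensional approximation of the path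
space and the energy characterisation `C(p) = {degenerate minimum} ∪ {≥ 2 minima}` (p. 119),
semianalytic and subanalytic sets with Hironaka's image theorem (pp. 119–121), and Hironaka's triangulation of
subanalytic sets (ref. [2] there). This file holds the **metric layer** that the identification
of the metric `cutLocus` of `CutLocus.lean` with Buchner's `C(p)` starts from — the part of the
Hopf–Rinow circle of ideas that needs no geodesic ODE, for the Riemannian distance
`d = g.edist hg` (`= Mathlib's riemannianEDist`):

* `edist_lt_top` — on a (pre)connected manifold `d(x, y) < ∞` (the set of points at finite
  distance from `x` is open and closed);
* `mem_cutLocus_of_forall_edist_le`, `cutLocus_nonempty` — a point at maximal distance from `p`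
  lies in the cut locus (no segment from `p` extends beyond it); hence on a compact connected
  Riemannian manifold with at least two points `cutLocus g hg p ≠ ∅` (the classical remark that
  the farthest point from `p` is a cut point; cut locus: Chavel 2006, §III.2);
* `exists_edist_eq_half_lt` — approximate midpoints: a `C¹` path of length `< d(x,y) + ε` passes
  through a point `m` with `d(x, m) = d(x, y)/2` and `d(m, y) < d(x, y)/2 + ε` (intermediate value
  theorem along the path + additivity of arc length);
* `exists_midpoint`, `one_le_minimalGeodesicMultiplicity` — on a compact connected Riemannian
  manifold any two points have a midpoint `d(x, m) = d(m, y) = d(x, y)/2` (minimise `d(·, y)` on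
  the compact sphere `{d(x, ·) = d/2}`), i.e. the multiplicity of minimal geodesics of
  `CutLocus.lean` is `≥ 1` — the metric form of the Hopf–Rinow existence of minimal segments on
  compact manifolds (O'Neill 1983, Ch. 5, Thm. 21 (Hopf–Rinow), Prop. 22, Cor. 23, and Lemma 24, whose
  proof minimises `d(·, q)` on a sphere about `p` exactly as here; Chavel 2006, Thm. I.7.1).

No definitions and no named facts are introduced (D-0026); everything is proved from Mathlib's
`riemannianEDist` API through `Literature.Geometry.Riemannian.RiemannianDistance`.

## References

* M. A. Buchner, *Simplicial structure of the real analytic cut locus*, Proc. AMS 64 (1977)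
  118–121 [Buchner1977Simplicial].
* B. O'Neill, *Semi-Riemannian geometry*, Academic Press 1983, Ch. 5 (Riemannian distance,
  Hopf–Rinow) [ONeill1983].
* I. Chavel, *Riemannian geometry: a modern introduction*, 2nd ed. (2006), §I.7 (Hopf–Rinow),
  §III.2 (cut locus) [Chavel2006].
-/

noncomputable section

open Bundle Set Filter Manifold
open scoped Manifold ContDiff Topology ENNReal

namespace Literature.Geometry.Riemannian

open Literature.Geometry.Lorentzian (PseudoRiemannianMetric)
open Literature.Geometry.Lorentzian.PseudoRiemannianMetric

variable {E : Type*} [NormedAddCommGroup E] [NormedSpace ℝ E] {H : Type*} [TopologicalSpace H]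
  {I : ModelWithCorners ℝ E H} {M : Type*} [TopologicalSpace M] [ChartedSpace H M]
  [IsManifold I ∞ M] {n : ℕ∞ω} [FiniteDimensional ℝ E]
  {g : PseudoRiemannianMetric I n E (TangentSpace I : M → Type _)}

/-! ### Finiteness of the Riemannian distance on connected manifolds -/

/-- The set of points at finite Riemannian distance from `x` is open: a point close to `y` in the
manifold topology is at distance `< 1` from `y` (Gouëzel, `eventually_riemannianEDist_lt`), and
`d(x, z) ≤ d(x, y) + d(y, z)`. [folklore] -/
theorem _root_.Literature.Geometry.Lorentzian.PseudoRiemannianMetric.isOpen_setOf_edist_lt_top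
    (hg : g.IsRiemannian) (x : M) : IsOpen {y | g.edist hg x y < ⊤} := by
  letI := g.riemannianBundle hg
  haveI := g.isContinuousRiemannianBundle hg
  rw [isOpen_iff_mem_nhds]
  intro y hy
  filter_upwards [eventually_riemannianEDist_lt I y (c := 1) one_pos] with z hz
  have hyz : g.edist hg y z < ⊤ := hz.trans_le le_top
  calc g.edist hg x z ≤ g.edist hg x y + g.edist hg y z := edist_triangle hg x y z
    _ < ⊤ := ENNReal.add_lt_top.2 ⟨hy, hyz⟩

/-- The set of points at finite Riemannian distance from `x` is closed: if `d(x, y) = ∞` then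
`d(x, z) = ∞` for all `z` near `y` (those with `d(y, z) < 1`). [folklore] -/
theorem _root_.Literature.Geometry.Lorentzian.PseudoRiemannianMetric.isClosed_setOf_edist_lt_top
    (hg : g.IsRiemannian) (x : M) : IsClosed {y | g.edist hg x y < ⊤} := by
  letI := g.riemannianBundle hg
  haveI := g.isContinuousRiemannianBundle hg
  rw [← isOpen_compl_iff, isOpen_iff_mem_nhds]
  intro y hy
  simp only [mem_compl_iff, mem_setOf_eq, not_lt, top_le_iff] at hy
  filter_upwards [eventually_riemannianEDist_lt I y (c := 1) one_pos] with z hz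
  simp only [mem_compl_iff, mem_setOf_eq, not_lt, top_le_iff]
  by_contra hne
  have hzy : g.edist hg z y < ⊤ := by
    rw [edist_comm hg z y]
    exact hz.trans_le le_top
  have hxy : g.edist hg x y < ⊤ :=
    calc g.edist hg x y ≤ g.edist hg x z + g.edist hg z y := edist_triangle hg x z y
      _ < ⊤ := ENNReal.add_lt_top.2 ⟨lt_top_iff_ne_top.2 hne, hzy⟩
  exact hxy.ne hy

/-- **The Riemannian distance on a connected manifold is finite**: `d(x, y) < ∞` for all `x, y`
of a (pre)connected manifold (the set of points at finite distance from `x` is open, closed and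
contains `x`) — O'Neill 1983, Ch. 5, before Def. 15: on a connected manifold any two points are
joined by a piecewise smooth curve, so `d(p, q)` is a (finite) real number. [cite: ONeill1983, Ch. 5, Def. 15 (p. 134)] -/
theorem _root_.Literature.Geometry.Lorentzian.PseudoRiemannianMetric.edist_lt_top [PreconnectedSpace M]
    (hg : g.IsRiemannian) (x y : M) : g.edist hg x y < ⊤ := by
  have hclopen : IsClopen {y | g.edist hg x y < ⊤} :=
    ⟨isClosed_setOf_edist_lt_top hg x, isOpen_setOf_edist_lt_top hg x⟩
  have hne : ({y | g.edist hg x y < ⊤} : Set M).Nonempty := ⟨x, by simp⟩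
  have huniv := hclopen.eq_univ hne
  have hy : y ∈ ({y | g.edist hg x y < ⊤} : Set M) := huniv ▸ mem_univ y
  exact hy

/-- On a connected manifold `d(x, y) ≠ ∞`. [cite: ONeill1983, Ch. 5, Def. 15 (p. 134)] -/
theorem _root_.Literature.Geometry.Lorentzian.PseudoRiemannianMetric.edist_ne_top [PreconnectedSpace M]
    (hg : g.IsRiemannian) (x y : M) : g.edist hg x y ≠ ⊤ :=
  (edist_lt_top hg x y).ne

/-! ### Farthest points are cut points -/

/-- **A point at maximal finite distance from `p` lies in the cut locus of `p`**: if `q ≠ p`,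
`d(p, q) < ∞` and `d(p, r) ≤ d(p, q)` for all `r`, then no minimal segment from `p` extends beyond
`q` — from `d(p, r) = d(p, q) + d(q, r)` we get `d(q, r) = 0`, i.e. `r = q` (definiteness, on `T₃`
manifolds). The classical remark that the farthest point from `p` is a cut point. [folklore] -/
theorem mem_cutLocus_of_forall_edist_le [T3Space M] (hg : g.IsRiemannian) {p q : M} (hqp : q ≠ p)
    (hfin : g.edist hg p q ≠ ⊤) (hmax : ∀ r, g.edist hg p r ≤ g.edist hg p q) :
    q ∈ cutLocus g hg p := by
  refine ⟨hqp, fun r hr => ?_⟩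
  have h1 : g.edist hg p q + g.edist hg q r ≤ g.edist hg p q + 0 := by
    rw [add_zero, ← hr]
    exact hmax r
  have h2 : g.edist hg q r = 0 :=
    nonpos_iff_eq_zero.1 ((ENNReal.add_le_add_iff_left hfin).1 h1)
  exact ((edist_eq_zero_iff hg).1 h2).symm

/-- **The cut locus of a point of a compact connected Riemannian manifold with at least two points
is nonempty**: the distance `d(p, ·)` is continuous and finite, so it attains its maximum at some
`q`; `q ≠ p` because some point is at positive distance from `p`, and `q ∈ cutLocus g hg p` by
`mem_cutLocus_of_forall_edist_le`. [folklore] -/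
theorem cutLocus_nonempty [CompactSpace M] [T2Space M] [ConnectedSpace M] [Nontrivial M]
    (hg : g.IsRiemannian) (p : M) : (cutLocus g hg p).Nonempty := by
  have hcont : Continuous fun y : M => g.edist hg p y :=
    (PseudoRiemannianMetric.continuous_edist hg).comp (Continuous.prodMk_right p)
  obtain ⟨q, -, hq⟩ := isCompact_univ.exists_isMaxOn univ_nonempty hcont.continuousOn
  have hmax : ∀ r, g.edist hg p r ≤ g.edist hg p q := fun r => isMaxOn_iff.1 hq r (mem_univ r)
  obtain ⟨x, hx⟩ := exists_ne p
  have hxpos : g.edist hg p x ≠ 0 := fun h => hx ((edist_eq_zero_iff hg).1 h).symm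
  have hqp : q ≠ p := by
    rintro rfl
    have h := hmax x
    rw [edist_self hg, nonpos_iff_eq_zero] at h
    exact hxpos h
  exact ⟨q, mem_cutLocus_of_forall_edist_le hg hqp (edist_ne_top hg p q) hmax⟩

/-! ### Midpoints (Hopf–Rinow on compact manifolds, metric form) -/

/-- **Approximate midpoints**: if `d(x, y) < ∞` and `ε > 0`, there is a point `m` with
`d(x, m) = d(x, y) / 2` and `d(m, y) < d(x, y) / 2 + ε`. Take a `C¹` path `γ` from `x` to `y` of
length `L < d(x, y) + ε` (definition of the distance as an infimum); the continuous function
`t ↦ d(x, γ t)` on `[0, 1]` takes the value `d(x, y)/2` at some `t` (intermediate value theorem);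
then `d(γ t, y) ≤ L(γ|[t,1]) = L − L(γ|[0,t]) ≤ L − d(x, γ t) < d(x, y)/2 + ε`. (The first step of
the classical proof that a complete/compact Riemannian manifold has minimal segments, O'Neill
1983, Ch. 5, Lemma 24; Chavel 2006, Thm. I.7.1.) [folklore] -/
theorem exists_edist_eq_half_lt [RegularSpace M] (hg : g.IsRiemannian) {x y : M}
    (hfin : g.edist hg x y ≠ ⊤) {ε : ℝ≥0∞} (hε : 0 < ε) :
    ∃ m, g.edist hg x m = g.edist hg x y / 2 ∧ g.edist hg m y < g.edist hg x y / 2 + ε := by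
  letI := g.riemannianBundle hg
  haveI := g.isContinuousRiemannianBundle hg
  set d := g.edist hg x y with hd
  have hlt : riemannianEDist I x y < d + ε := ENNReal.lt_add_right hfin hε.ne'
  obtain ⟨γ, hγ0, hγ1, hγ, hL⟩ := exists_lt_of_riemannianEDist_lt (I := I) hlt
  have hLfin : pathELength I γ 0 1 < ⊤ := hL.trans_le le_top
  -- arc length splits at every `t ∈ [0, 1]`
  have hlen : ∀ t ∈ Icc (0 : ℝ) 1,
      pathELength I γ 0 t + pathELength I γ t 1 = pathELength I γ 0 1 :=
    fun t ht => pathELength_add ht.1 ht.2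
  -- the distance from `x` to `γ t`, resp. from `γ t` to `y`, is at most the partial length
  have hxt : ∀ t ∈ Icc (0 : ℝ) 1, g.edist hg x (γ t) ≤ pathELength I γ 0 t := fun t ht =>
    riemannianEDist_le_pathELength (I := I) (hγ.mono (Icc_subset_Icc_right ht.2)) hγ0 rfl ht.1
  have hty : ∀ t ∈ Icc (0 : ℝ) 1, g.edist hg (γ t) y ≤ pathELength I γ t 1 := fun t ht =>
    riemannianEDist_le_pathELength (I := I) (hγ.mono (Icc_subset_Icc_left ht.1)) rfl hγ1 ht.2
  have hfin' : ∀ t ∈ Icc (0 : ℝ) 1, g.edist hg x (γ t) ≠ ⊤ := fun t ht =>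
    ne_top_of_le_ne_top hLfin.ne ((hxt t ht).trans (pathELength_mono le_rfl ht.2))
  -- the continuous real function `t ↦ d(x, γ t)` on `[0, 1]`
  set φ : ℝ → ℝ := fun t => (g.edist hg x (γ t)).toReal with hφ
  have hdc : Continuous fun z : M => g.edist hg x z :=
    (PseudoRiemannianMetric.continuous_edist hg).comp (Continuous.prodMk_right x)
  have hφc : ContinuousOn φ (Icc 0 1) := by
    have h1 : ContinuousOn (fun t => g.edist hg x (γ t)) (Icc 0 1) :=
      hdc.comp_continuousOn hγ.continuousOn
    exact ENNReal.continuousOn_toReal.comp h1 fun t ht => hfin' t ht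
  have hφ0 : φ 0 = 0 := by simp [hφ, hγ0]
  have hφ1 : φ 1 = d.toReal := by simp [hφ, hγ1, hd]
  -- intermediate value theorem: `d(x, γ t) = d / 2` for some `t`
  have hmem : d.toReal / 2 ∈ Icc (φ 0) (φ 1) := by
    rw [hφ0, hφ1]
    exact ⟨by positivity, half_le_self ENNReal.toReal_nonneg⟩
  obtain ⟨t, ht, hφt⟩ := intermediate_value_Icc zero_le_one hφc hmem
  have hxm : g.edist hg x (γ t) = d / 2 := by
    have h1 : g.edist hg x (γ t) = ENNReal.ofReal (φ t) := (ENNReal.ofReal_toReal (hfin' t ht)).symm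
    rw [h1, hφt, ENNReal.ofReal_div_of_pos two_pos, ENNReal.ofReal_toReal hfin, ENNReal.ofReal_ofNat]
  refine ⟨γ t, hxm, (hty t ht).trans_lt ?_⟩
  -- `d/2 + L(γ|[t,1]) ≤ L(γ|[0,t]) + L(γ|[t,1]) = L < d + ε = d/2 + (d/2 + ε)`
  have h2fin : d / 2 ≠ ⊤ := ne_top_of_le_ne_top hfin ENNReal.half_le_self
  have key : d / 2 + pathELength I γ t 1 < d / 2 + (d / 2 + ε) :=
    calc d / 2 + pathELength I γ t 1 ≤ pathELength I γ 0 t + pathELength I γ t 1 :=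
          add_le_add_left (hxm.symm.le.trans (hxt t ht)) _
      _ = pathELength I γ 0 1 := hlen t ht
      _ < d + ε := hL
      _ = d / 2 + (d / 2 + ε) := by rw [← add_assoc, ENNReal.add_halves]
  exact (ENNReal.add_lt_add_iff_left h2fin).1 key

/-- **Midpoints exist on compact connected Riemannian manifolds**: for all `x, y` there is `m`
with `d(x, m) = d(m, y)` and `d(x, m) + d(m, y) = d(x, y)` (so both equal `d(x, y)/2`). Proof:
`d = d(x, y)` is finite (`edist_lt_top`); the level set `S = {m | d(x, m) = d/2}` is closed, hence
compact, and nonempty by `exists_edist_eq_half_lt`; a minimiser `m ∈ S` of the continuous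
function `d(·, y)` has `d(m, y) ≤ d/2 + ε` for every `ε > 0` (again by `exists_edist_eq_half_lt`),
so `d(m, y) ≤ d/2`, and `d ≤ d(x, m) + d(m, y)` forces `d(m, y) = d/2`. This is the metric
content of the Hopf–Rinow theorem on compact manifolds (existence of minimal segments: O'Neill
1983, Ch. 5, Prop. 22 and Lemma 24; Chavel 2006, Thm. I.7.1); iterating it gives minimal
geodesics once the local theory is available. [folklore] -/
theorem exists_midpoint [CompactSpace M] [T2Space M] [ConnectedSpace M] (hg : g.IsRiemannian)
    (x y : M) :
    ∃ m, g.edist hg x m = g.edist hg m y ∧ g.edist hg x m + g.edist hg m y = g.edist hg x y := by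
  set d := g.edist hg x y with hd
  have hfin : d ≠ ⊤ := edist_ne_top hg x y
  have h2fin : d / 2 ≠ ⊤ := ne_top_of_le_ne_top hfin ENNReal.half_le_self
  have hdx : Continuous fun z : M => g.edist hg x z :=
    (PseudoRiemannianMetric.continuous_edist hg).comp (Continuous.prodMk_right x)
  have hdy : Continuous fun z : M => g.edist hg z y :=
    (PseudoRiemannianMetric.continuous_edist hg).comp (continuous_id.prodMk continuous_const)
  set S : Set M := {m | g.edist hg x m = d / 2} with hS
  have hSc : IsCompact S := (isClosed_eq hdx continuous_const).isCompact
  have hSne : S.Nonempty := by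
    obtain ⟨m, hm, -⟩ := exists_edist_eq_half_lt hg hfin one_pos
    exact ⟨m, hm⟩
  obtain ⟨m, hmS, hmin⟩ := hSc.exists_isMinOn hSne hdy.continuousOn
  have hmx : g.edist hg x m = d / 2 := hmS
  -- `d(m, y) ≤ d/2 + ε` for every `ε > 0`
  have hmy_le : g.edist hg m y ≤ d / 2 := by
    refine ENNReal.le_of_forall_pos_le_add fun ε hε _ => ?_
    obtain ⟨m', hm', hlt⟩ := exists_edist_eq_half_lt hg hfin (ε := ε) (by exact_mod_cast hε)
    exact (isMinOn_iff.1 hmin m' hm').trans hlt.le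
  -- `d ≤ d(x, m) + d(m, y) = d/2 + d(m, y)` forces `d/2 ≤ d(m, y)`
  have hmy_ge : d / 2 ≤ g.edist hg m y := by
    have h := edist_triangle hg x m y
    rw [← hd, hmx] at h
    conv_lhs at h => rw [← ENNReal.add_halves d]
    exact (ENNReal.add_le_add_iff_left h2fin).1 h
  have hmy : g.edist hg m y = d / 2 := le_antisymm hmy_le hmy_ge
  refine ⟨m, by rw [hmx, hmy], ?_⟩
  rw [hmx, hmy, ENNReal.add_halves]

/-- On a compact connected Riemannian manifold every pair of points has **at least one midpoint**:
the multiplicity of minimal geodesics `minimalGeodesicMultiplicity g hg p q` of `CutLocus.lean`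
(the number of midpoints) is `≥ 1` (Hopf–Rinow: any two points of a compact connected Riemannian
manifold are joined by a minimal segment; O'Neill 1983, Ch. 5, Prop. 22 and Lemma 24). [folklore] -/
theorem one_le_minimalGeodesicMultiplicity [CompactSpace M] [T2Space M] [ConnectedSpace M]
    (hg : g.IsRiemannian) (p q : M) : 1 ≤ minimalGeodesicMultiplicity g hg p q := by
  rw [minimalGeodesicMultiplicity_eq_encard, Set.one_le_encard_iff_nonempty]
  obtain ⟨m, h1, h2⟩ := exists_midpoint hg p q
  exact ⟨m, h1, h2⟩

end Literature.Geometry.Riemannian
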